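import Mathlib.Analysis.SpecialFunctions.Complex.Arg
import Mathlib.Analysis.SpecialFunctions.Complex.Log
import HarnessLib

/-!
# N1-move, bridge (e×) `piece_e_cross`, tool 8: angle bookkeeping of the swept arc (wave 8, worker J4,
# brick of stub `stub_M2geo` = node N1 ▸ contract `node_N1_move_of_pieces` ▸ `HD` = `piece_e_cross piece_d`,
# line `modp-braid-orbits`, crux `ConvexBisection.AcyclicBisectionExists`, item stmt-SmoothPoincare4-10508;
# registered sub-goal `helper_arg_pos_mul_exp`)

The bridge (e×) measures the LEVEL of a boundary point of the swept slab (directions `c₀ e^{iτ}`,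
`τ` between `0` and `T`, `|T| < 2π`) by the argument of its `w`-coordinate divided by the mid-direction
`c₀ e^{iT/2}`, so that all arguments lie in `(−π, π)`.  This file supplies the three elementary facts:
`arg_pos_mul_exp` (`arg (c e^{iθ}) = θ` for `c > 0`, `|θ| < π`), `continuousAt_arg_pos_mul_exp`
(`arg` is continuous there), `eq_of_exp_mul_I_eq` (`e^{iα} = e^{iβ}` with `|α − β| < 2π` forces
`α = β`).  Everything is proved; no definitions, no named facts, no `sorry`. [folklore]
-/

noncomputable section

set_option linter.dupNamespace false

open Set Real

namespace Summit.SmoothPoincare4.SmoothPoincare4.Theorems.AcyclicBisectionExists.ModpBraidOrbits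

namespace CrossAngles

/-- **`arg (c e^{iθ}) = θ`** for `c > 0` and `θ ∈ (−π, π)`. [folklore] -/
theorem arg_pos_mul_exp {c θ : ℝ} (hc : 0 < c) (hθ : θ ∈ Ioo (-π) π) :
    Complex.arg ((c : ℂ) * Complex.exp ((θ : ℂ) * Complex.I)) = θ := by
  rw [Complex.arg_real_mul _ hc, Complex.arg_exp_mul_I]
  exact (toIocMod_eq_self _).2 ⟨hθ.1, by linarith [hθ.2]⟩

/-- `c e^{iθ}` (`c > 0`, `|θ| < π`) lies in the slit plane, so **`arg` is continuous there**. [folklore] -/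
theorem continuousAt_arg_pos_mul_exp {c θ : ℝ} (hc : 0 < c) (hθ : θ ∈ Ioo (-π) π) :
    ContinuousAt Complex.arg ((c : ℂ) * Complex.exp ((θ : ℂ) * Complex.I)) := by
  refine Complex.continuousAt_arg (Complex.mem_slitPlane_iff_arg.2 ⟨?_, ?_⟩)
  · rw [arg_pos_mul_exp hc hθ]; exact hθ.2.ne
  · exact mul_ne_zero (by exact_mod_cast hc.ne') (Complex.exp_ne_zero _)

/-- **`e^{iα} = e^{iβ}` with `|α − β| < 2π` forces `α = β`.** [folklore] -/
theorem eq_of_exp_mul_I_eq {α β : ℝ} (h : Complex.exp ((α : ℂ) * Complex.I) = Complex.exp ((β : ℂ) * Complex.I))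
    (hαβ : |α - β| < 2 * π) : α = β := by
  obtain ⟨m, hm⟩ := Complex.exp_eq_exp_iff_exists_int.1 h
  have hre : α = β + m * (2 * π) := by
    have := congrArg Complex.im hm
    simpa using this
  have hm0 : (m : ℝ) = 0 := by
    have h1 : |(m : ℝ)| * (2 * π) < 1 * (2 * π) := by
      rw [← abs_of_pos Real.two_pi_pos, ← abs_mul, one_mul, abs_of_pos Real.two_pi_pos]
      rw [show (m : ℝ) * (2 * π) = α - β by rw [hre]; ring]
      exact hαβ
    have h2 : |(m : ℝ)| < 1 := lt_of_mul_lt_mul_right h1 Real.two_pi_pos.le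
    have h3 : |m| < 1 := by exact_mod_cast h2
    exact_mod_cast Int.abs_lt_one_iff.1 h3
  rw [hre, hm0, zero_mul, add_zero]

/-- The difference of two points of a segment of length `< ℓ` is `< ℓ` in absolute value: for
`t, t' ∈ [0, 1]`, `|t T − t' T| ≤ |T|`. [folklore] -/
theorem abs_sub_mul_le {t t' T : ℝ} (ht : t ∈ Icc (0 : ℝ) 1) (ht' : t' ∈ Icc (0 : ℝ) 1) :
    |t * T - t' * T| ≤ |T| := by
  rw [← sub_mul, abs_mul]
  have h : |t - t'| ≤ 1 := by rw [abs_le]; constructor <;> linarith [ht.1, ht.2, ht'.1, ht'.2]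
  calc |t - t'| * |T| ≤ 1 * |T| := by gcongr
    _ = |T| := one_mul _

end CrossAngles

open CrossAngles

/-! ## The registered form -/

/-- **Sub-goal `helper_arg_pos_mul_exp`** (J4, bridge (e×) of the N1 contract, tool 8, fully qualified):
`arg (c e^{iθ}) = θ` for `c > 0` and `θ ∈ (−π, π)`. [folklore] -/
theorem helper_arg_pos_mul_exp : ∀ (c θ : ℝ), 0 < c → θ ∈ Set.Ioo (-Real.pi) Real.pi → Complex.arg ((c : ℂ) * Complex.exp ((θ : ℂ) * Complex.I)) = θ :=
  fun _ _ hc hθ => arg_pos_mul_exp hc hθ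

end Summit.SmoothPoincare4.SmoothPoincare4.Theorems.AcyclicBisectionExists.ModpBraidOrbits

end
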